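import Summits.QuantumFields.YangMills.Theorems.LuscherReductionOneSiteLevelsValleyShell2
import Summits.QuantumFields.YangMills.Theorems.LuscherReductionOneSiteLevelsValleySchur

/-!
# VALLEY, step 5c: the static assembly — the valley form bound with explicit parameters
# (support module for `stub_absUpperValleyMag` of crux `OneSiteLevels`, route `LuscherReduction`, item stmt-QuantumFields-20007;
# fleet lead prover ym-luscher-20007-p1 g2)

`valley_qform_le_static`: the two-shell assembly `qform_le_of_twoShell` fed with the shell bounds `shell1_J_le`, `shell2_J_le'`.  For
parameters `T, w, ρ₀, δ', γ` and `J ∈ ℕ` satisfying finitely many explicit numerical inequalities (all of which hold for the choice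
`T = B^{-1/12}`, `w = B^{-5/12}`, `δ' = B^{-2/3}`, `ρ₀ = √λ_b/2`, `γ = B^{-1/4}/1000`, `J = ⌊B^{1/3}/2⌋` and `B` large, see `…ValleyMain`):
every bounded measurable `f` vanishing on `{ρ < ρ₀}` obeys `qform_B(f,f) ≤ (linkCE B(1 − γ) + linkCE B/J + 2e^{6B − Bw²}) ‖f‖²`.

## WHAT THIS IS NOT
Not yet the stub (parameters are instantiated in `…ValleyMain`); NOT the crux, NOT THE CLAY GAP.  Sorry-free; no new definition, no named fact.
-/

set_option autoImplicit false

noncomputable section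

open MeasureTheory Filter Topology Real
open scoped Matrix Quaternion RealInnerProductSpace BigOperators
open Literature.MathematicalPhysics.QuantumFieldTheory
open Literature.MathematicalPhysics.QuantumLattice
open Literature.Analysis.OperatorTheory.YMMatrixModel

namespace Summit.QuantumFields.YangMills.Theorems.FemtoTransferGap

variable {B : ℝ}

/-- **The static valley bound.** [cite: SimonB1983DiscreteSpectrum, §2] [cite: Luscher1983, §2] -/
theorem valley_qform_le_static (hB : 54 ≤ B) {T w ρ₀ δ' γ : ℝ} {J : ℕ} (hT : T + 1 / 8 ≤ 7 / 50) (hw : 0 < w)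
    (hρ₀0 : 0 < ρ₀) (hρ₀w : ρ₀ + w ≤ T) (hJ : 0 < J) (hJw : T + 2 * J * w ≤ 2 * T) (hδ'0 : 0 < δ') (hδ' : δ' ≤ 1 / 72)
    (hε₁ : 9 / 4 * δ' + (1 / 2 + 1 / (8 * T)) * (2 * Real.sqrt 2 * √(10 / B) + 9 * δ' * (2 + 36 * δ')) ≤ 1 / 18)
    (hε₂ : 9 / 4 * δ' + 1 / 2 * (2 * Real.sqrt 2 * √(1 / (100000 * B)) + 9 * δ' * (2 + 36 * δ')) ≤ 1 / 18)
    (hγ : γ ≤ 1)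
    (h1a : 16 * Real.sqrt 2 * Real.exp (-5) ≤ (1 - 27 / B) * (1 - γ))
    (h1b : (1 + 18 * (9 / 4 * δ' + (1 / 2 + 1 / (8 * T)) * (2 * Real.sqrt 2 * √(10 / B) + 9 * δ' * (2 + 36 * δ'))))
        * (1 - 5 / 16 * min (1 / (16 * T) * (1 - 36 * δ') * ρ₀ ^ 2) (1 / 500)) + 512 * Real.exp (-(B * δ' / 4))
      ≤ (1 - 27 / B) * (1 - γ))
    (h2a : Real.exp (-(1 / 200000)) ≤ (1 - 27 / B) * (1 - γ))
    (h2b : (1 + 18 * (9 / 4 * δ' + 1 / 2 * (2 * Real.sqrt 2 * √(1 / (100000 * B)) + 9 * δ' * (2 + 36 * δ'))))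
        * (1 - 5 / 16 * min (1 / 2 * (1 - 36 * δ') * T ^ 2) (1 / 500)) + 512 * Real.exp (-(B * δ' / 4))
      ≤ (1 - 27 / B) * (1 - γ))
    (h2c : (1 + 18 * (9 / 4 * δ' + 1 / 2 * (2 * Real.sqrt 2 * √(1 / (100000 * B)) + 9 * δ' * (2 + 36 * δ'))))
        * Real.exp ((27 / 4 + 9 * δ') / 100000) * (1 - 5 / 16 * (1 / 500)) + 512 * Real.exp (-(B * δ' / 4))
      ≤ (1 - 27 / B) * (1 - γ))
    {f : Cfg → ℝ} (hfm : Measurable f) (hfb : ∃ C : ℝ, ∀ U, |f U| ≤ C) (hf0 : ∀ U, ‖zmCoord 1 U‖ < ρ₀ → f U = 0) :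
    qform su2Rep B f f ≤ (linkCE B * (1 - γ) + linkCE B / J + 2 * Real.exp (6 * B - B * w ^ 2)) * l2 f f := by
  have hB0 : 0 < B := by linarith
  have hT0 : 0 < T := by linarith
  have h27 : 0 < 1 - 27 / B := by rw [sub_pos, div_lt_one hB0]; linarith
  have hL : 0 < linkCE B := linkCE_pos hB0.le
  have hγ' : 0 ≤ 1 - γ := by linarith
  have hΛ : 0 ≤ linkCE B * (1 - γ) := mul_nonneg hL.le hγ'
  have hconv : ∀ x : ℝ, x ≤ (1 - 27 / B) * (1 - γ) → linkCE B / (1 - 27 / B) * x ≤ linkCE B * (1 - γ) := by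
    intro x hx
    calc linkCE B / (1 - 27 / B) * x ≤ linkCE B / (1 - 27 / B) * ((1 - 27 / B) * (1 - γ)) :=
          mul_le_mul_of_nonneg_left hx (div_nonneg hL.le h27.le)
      _ = linkCE B * (1 - γ) := by rw [← mul_assoc, div_mul_cancel₀ _ h27.ne']
  refine qform_le_of_twoShell hB0 hw hρ₀w hJ hJw hΛ (fun t => 1 / (8 * t)) ?_ ?_ hfm hfb hf0
  · intro t htT ht2T U hρ₀U hρt
    refine (shell1_J_le hB hT0 hT htT ht2T hδ'0 hδ' hε₁ hρ₀0 U hρ₀U hρt).trans (hconv _ (max_le h1a h1b))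
  · intro t htT ht2T U hρt
    have ht0 : 0 < t := lt_of_lt_of_le hT0 htT
    refine (shell2_J_le' hB ht0 hδ'0 hδ' hε₂ U hρt).trans (hconv _ (max_le h2a (max_le ?_ h2c)))
    refine le_trans ?_ h2b
    refine add_le_add_left (mul_le_mul_of_nonneg_left ?_ (by positivity)) _
    have hmono : min (1 / 2 * (1 - 36 * δ') * T ^ 2) (1 / 500) ≤ min (1 / 2 * (1 - 36 * δ') * t ^ 2) (1 / 500) := by
      refine min_le_min (mul_le_mul_of_nonneg_left (pow_le_pow_left₀ hT0.le htT 2) ?_) le_rfl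
      have : 0 ≤ 1 - 36 * δ' := by linarith
      positivity
    linarith

end Summit.QuantumFields.YangMills.Theorems.FemtoTransferGap

end
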